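import Summits.QuantumFields.BalabanUV.Beta.D1BFx.ColourLift

/-!
# `BalabanUV.Beta.FP.ColourDoubling` — road «FP» for binder row D1, ROUTE T, located finding F-FP-18-2 ∕ resolution F-FP-18-3 = road «BF-x»'s
# ANTISYMMETRIC COLOUR LIFT (`D1BFx.ColourLift`, K-TA4C, owner finding F-g6-1) READ FOR `secondVar`:
# **the one-loop functional of the lifted jets `(1 ⊗ A₀, c ⊗ A₁, (c·c) ⊗ A₂)` is `tr(c·c)` times the stripped one (`−2` at `c = cgen`),
# and lifted odd jets of ANTISYMMETRIC tables are SYMMETRIC**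

WHY (journal [D1P3-G18-F2] l.41032 ∕ [F2-A1] l.41041 ∕ [F3] l.41136; d1-p2's W-d1p2-g18-10 l.41159; memo `N2B-DESIGN.md` §25).  The colour-stripped
literal's first-order form table is ANTISYMMETRIC (`AveragingHessianKernelsRooted.hessFFAt_antisymm`; an1's `symHessFFAt_antisymm`, W-an1-g64-1
l.41125), so the road's real, transpose-two-sided Ward letters (`a1t a2t` of the slice exchange p308565) and the T-β congruence letter `k1` cannot hold
for it as typed.  Road «BF-x» met the same wall and routes around it by the antisymmetric colour lift `D1BFx.ColourLift` (`cgen = [[0,1],[−1,0]]`,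
`cgenᵀ = −cgen`, `cgen² = −1`, `tr cgen² = −2`; Kronecker lifts versus `kkt`∕`fromRows` up to re-indexing; the UNIFORM colour factor of `mixedVar`∕`hessT`;
the two-sided relations of lifted jets from one-sided ones, `lift_rel₁_transpose` …).  This file is the two-line `secondVar` reading of that module the
«FP» door needs, BY NAME — nothing of `ColourLift` restated, no definition, no grading matrix of our own:
* `secondVar_kronecker_lift : secondVar (1 ⊗ₖ A₀) (c ⊗ₖ A₁) ((c * c) ⊗ₖ A₂) = tr(c·c) · secondVar A₀ A₁ A₂` for ANY colour matrix `c` and ANY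
  2-jet (no invertibility, symmetry or Ward hypothesis) — `mixedVar_self` + `ColourLift.mixedVar_kronecker_lift`; at `c := cgen` the factor is `−2`
  (`secondVar_cgen_lift`), the same for the one-shot, the fine and the coarse system, so any finite-`j` law among stripped `secondVar`s holds iff
  it holds for the lifted, SYMMETRIC-bordered jets;
* `kronecker_lift_transpose_of_antisymm : cᵀ = −c → Xᵀ = −X → (c ⊗ₖ X)ᵀ = c ⊗ₖ X` (lifted odd jets of antisymmetric tables are symmetric — the
  two-sided letters become the one-sided ones), `kronecker_lift_transpose_of_symm` for the even jets, `cgen` instances;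
* `kronecker_lift_mul : (c ⊗ₖ X) * (c ⊗ₖ Y) = (c * c) ⊗ₖ (X * Y)` — the product rule respects the grading (degree-2 words carry `c·c`), so the
  composite namings `h𝔎ₙ h𝔔ₙ` of p308750 lift consistently;
* §3 `fromCols_kronecker` ∕ `kronecker_fromCols_zero` ∕ `mul_reindex_refl_e₂` — the column twin of `ColourLift.fromRows_kronecker`: the one junction every
  lifted ROW needs (`[D̄ ∣ 0] ↦ [c ⊗ D̄ ∣ 0]` up to `e₂`; leaf-02 g19 W-3).
USE (option (δ) of the R-FP-54 decision, the OWNER's; nothing of the dictionary asserted here): instantiate the torus calls (p313662 ∕ Delta ∕ Rows ∕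
T-β ∕ S1) at index types `Fin 2 × …` with the `cgen`-lifted tables; the displayed letters become GRADED one-sided identities of the stripped tables.

HONEST DEPENDENCY (page 1, mandatory): continuum YM on T⁴ ⇐ BetaPertH ∧ nine spine estimates (0/9 proved); BetaPertH ⇐ (D1) ∧ (D4) ∧ CAP+tail;
G-an2-4 gates asym, D1 and NE2/3/4.  HONEST FRAMING (cell contract, verbatim): «discharging `BetaPertH` makes Bałaban's UV stability UNCONDITIONAL —
a real constructive-QFT result; it is NOT the continuum limit and NOT the Clay problem.»  ABSOLUTE RULE (cell charter, verbatim): «No internally-minted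
statement may enter as a cited fact. Every hypothesis is either kernel-proved in this package or a verbatim quotation of a PUBLISHED theorem with page
reference. The manuscript(s) under audit are NOT citable for their own disputed steps — they are the thing under adjudication; programme-internal
(2001/route/tribunal) claims are never citable.»  No `def`, no `def … : Prop`, nothing cited, 0 sorry; 0 estimates; 0∕4 row-D1 binders; NOT (T-ID),
NOT SDF, NOT D1, NOT BetaPertH, NOT continuum, NOT Clay.  Road «FP» OWNER, b2b-balaban-beta-d1-p3 gen 18, 2026-08-22.  No existing file touched.
-/

noncomputable section

namespace Summit.QuantumFields.BalabanUV.Beta.FP.ColourDoubling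

open Matrix
open scoped Kronecker
open Summit.QuantumFields.BalabanUV.Beta.D1BFx.LogDetSecondVariation (secondVar)
open Summit.QuantumFields.BalabanUV.Beta.D1BFx.SliceTransferJetsMixed (mixedVar_self)
open Summit.QuantumFields.BalabanUV.Beta.D1BFx.ColourLift (cgen cgen_transpose cgen_mul_cgen trace_cgen_mul_cgen cgen_sq_transpose
  mixedVar_kronecker_lift kronecker_transpose' neg_kronecker_neg e₂ e₂_symm_inl e₂_symm_inr)

variable {l ι : Type*} [Fintype l] [Fintype ι] [DecidableEq l] [DecidableEq ι]

/-! ## §1 The uniform colour factor of `secondVar` -/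

/-- [folklore] **THE ONE-LOOP FUNCTIONAL OF THE LIFTED JETS**: for ANY colour matrix `c` and ANY 2-jet `(A₀, A₁, A₂)` (no invertibility, symmetry or
Ward hypothesis), `secondVar (1 ⊗ₖ A₀) (c ⊗ₖ A₁) ((c·c) ⊗ₖ A₂) = tr(c·c) · secondVar A₀ A₁ A₂` — tadpole and bubble BOTH carry exactly `c·c`
(`ColourLift.mixedVar_kronecker_lift` on the diagonal, `mixedVar_self`). -/
theorem secondVar_kronecker_lift (c : Matrix l l ℝ) (A₀ A₁ A₂ : Matrix ι ι ℝ) :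
    secondVar ((1 : Matrix l l ℝ) ⊗ₖ A₀) (c ⊗ₖ A₁) ((c * c) ⊗ₖ A₂) = (c * c).trace * secondVar A₀ A₁ A₂ := by
  rw [← mixedVar_self, ← mixedVar_self]
  exact mixedVar_kronecker_lift c A₀ A₁ A₁ A₂

/-- [folklore] **AT THE ROAD'S COLOUR GENERATOR `cgen` (`cgen² = −1`, `tr cgen² = −2`) THE FACTOR IS `−2`**, uniformly for every system:
`secondVar (1 ⊗ₖ A₀) (cgen ⊗ₖ A₁) ((cgen·cgen) ⊗ₖ A₂) = −2 · secondVar A₀ A₁ A₂`. -/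
theorem secondVar_cgen_lift (A₀ A₁ A₂ : Matrix ι ι ℝ) :
    secondVar ((1 : Matrix (Fin 2) (Fin 2) ℝ) ⊗ₖ A₀) (cgen ⊗ₖ A₁) ((cgen * cgen) ⊗ₖ A₂) = -2 * secondVar A₀ A₁ A₂ := by
  rw [secondVar_kronecker_lift, trace_cgen_mul_cgen]

/-- [folklore] the same with the second lifted jet written `(−1) ⊗ₖ A₂` (`cgen·cgen = −1`). -/
theorem secondVar_cgen_lift' (A₀ A₁ A₂ : Matrix ι ι ℝ) :
    secondVar ((1 : Matrix (Fin 2) (Fin 2) ℝ) ⊗ₖ A₀) (cgen ⊗ₖ A₁) ((-1 : Matrix (Fin 2) (Fin 2) ℝ) ⊗ₖ A₂) = -2 * secondVar A₀ A₁ A₂ := by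
  rw [← cgen_mul_cgen]
  exact secondVar_cgen_lift A₀ A₁ A₂

/-- [folklore] consequently ANY linear relation among stripped `secondVar`s transfers both ways: for reals `x y z` and jets,
`secondVar(lift P) = secondVar(lift T) + secondVar(lift F) ↔ secondVar P = secondVar T + secondVar F` (the shape of the finite-`j` step law (N2b)). -/
theorem secondVar_cgen_lift_law_iff (P₀ P₁ P₂ T₀ T₁ T₂ F₀ F₁ F₂ : Matrix ι ι ℝ) :
    secondVar ((1 : Matrix (Fin 2) (Fin 2) ℝ) ⊗ₖ P₀) (cgen ⊗ₖ P₁) ((cgen * cgen) ⊗ₖ P₂)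
        = secondVar ((1 : Matrix (Fin 2) (Fin 2) ℝ) ⊗ₖ T₀) (cgen ⊗ₖ T₁) ((cgen * cgen) ⊗ₖ T₂)
          + secondVar ((1 : Matrix (Fin 2) (Fin 2) ℝ) ⊗ₖ F₀) (cgen ⊗ₖ F₁) ((cgen * cgen) ⊗ₖ F₂)
      ↔ secondVar P₀ P₁ P₂ = secondVar T₀ T₁ T₂ + secondVar F₀ F₁ F₂ := by
  rw [secondVar_cgen_lift, secondVar_cgen_lift, secondVar_cgen_lift]
  constructor
  · intro h; linarith
  · intro h; rw [h]; ring

/-! ## §2 Lifted odd jets of antisymmetric tables are symmetric; the product rule respects the grading -/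

omit [Fintype l] [Fintype ι] [DecidableEq l] [DecidableEq ι] in
/-- [folklore] **LIFTED ODD JETS OF ANTISYMMETRIC TABLES ARE SYMMETRIC**: `cᵀ = −c`, `Xᵀ = −X ⇒ (c ⊗ₖ X)ᵀ = c ⊗ₖ X`
(`ColourLift.kronecker_transpose'` + `ColourLift.neg_kronecker_neg`). -/
theorem kronecker_lift_transpose_of_antisymm {c : Matrix l l ℝ} {X : Matrix ι ι ℝ} (hc : cᵀ = -c) (hX : Xᵀ = -X) : (c ⊗ₖ X)ᵀ = c ⊗ₖ X := by
  rw [kronecker_transpose', hc, hX]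
  exact neg_kronecker_neg c X

omit [Fintype l] [Fintype ι] [DecidableEq l] [DecidableEq ι] in
/-- [folklore] lifted even jets of symmetric tables are symmetric: `eᵀ = e`, `Xᵀ = X ⇒ (e ⊗ₖ X)ᵀ = e ⊗ₖ X`. -/
theorem kronecker_lift_transpose_of_symm {e : Matrix l l ℝ} {X : Matrix ι ι ℝ} (he : eᵀ = e) (hX : Xᵀ = X) : (e ⊗ₖ X)ᵀ = e ⊗ₖ X := by
  rw [kronecker_transpose', he, hX]

omit [Fintype ι] [DecidableEq ι] in
/-- [folklore] `cgen` instances: an ANTISYMMETRIC first-order table lifts to a SYMMETRIC jet `cgen ⊗ₖ X`, a symmetric zeroth ∕ second-order table to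
symmetric jets `1 ⊗ₖ X`, `(cgen·cgen) ⊗ₖ X`. -/
theorem cgen_lift_transpose {X₀ X₁ X₂ : Matrix ι ι ℝ} (h₀ : X₀ᵀ = X₀) (h₁ : X₁ᵀ = -X₁) (h₂ : X₂ᵀ = X₂) :
    (((1 : Matrix (Fin 2) (Fin 2) ℝ) ⊗ₖ X₀)ᵀ = (1 : Matrix (Fin 2) (Fin 2) ℝ) ⊗ₖ X₀) ∧ ((cgen ⊗ₖ X₁)ᵀ = cgen ⊗ₖ X₁)
      ∧ (((cgen * cgen) ⊗ₖ X₂)ᵀ = (cgen * cgen) ⊗ₖ X₂) :=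
  ⟨kronecker_lift_transpose_of_symm Matrix.transpose_one h₀, kronecker_lift_transpose_of_antisymm cgen_transpose h₁,
    kronecker_lift_transpose_of_symm cgen_sq_transpose h₂⟩

omit [DecidableEq l] [DecidableEq ι] in
/-- [folklore] **THE PRODUCT RULE RESPECTS THE GRADING**: `(c ⊗ₖ X) * (c ⊗ₖ Y) = (c·c) ⊗ₖ (X·Y)` (degree-2 words carry `c·c`; at `cgen`, `−1`). -/
theorem kronecker_lift_mul (c : Matrix l l ℝ) (X Y : Matrix ι ι ℝ) : (c ⊗ₖ X) * (c ⊗ₖ Y) = (c * c) ⊗ₖ (X * Y) :=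
  (Matrix.mul_kronecker_mul c c X Y).symm

omit [DecidableEq l] [DecidableEq ι] in
/-- [folklore] mixed-degree products: `(1 ⊗ₖ X) * (c ⊗ₖ Y) = c ⊗ₖ (X·Y)` and `(c ⊗ₖ X) * (1 ⊗ₖ Y) = c ⊗ₖ (X·Y)`. -/
theorem kronecker_lift_mul_one [DecidableEq l] (c : Matrix l l ℝ) (X Y : Matrix ι ι ℝ) :
    ((1 : Matrix l l ℝ) ⊗ₖ X) * (c ⊗ₖ Y) = c ⊗ₖ (X * Y) ∧ (c ⊗ₖ X) * ((1 : Matrix l l ℝ) ⊗ₖ Y) = c ⊗ₖ (X * Y) := by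
  constructor
  · rw [← Matrix.mul_kronecker_mul, Matrix.one_mul]
  · rw [← Matrix.mul_kronecker_mul, Matrix.mul_one]

/-! ## §3 The one junction every lifted ROW needs (leaf-02 g19 W-3 l.41221): Kronecker commutes with `fromCols` (up to `e₂` on the columns) -/

omit [Fintype l] [Fintype ι] [DecidableEq l] [DecidableEq ι] in
/-- [folklore] **KRONECKER COMMUTES WITH `fromCols`** (the column twin of `ColourLift.fromRows_kronecker`):
`fromCols (c ⊗ₖ A) (c ⊗ₖ B) = reindex (refl) e₂ (c ⊗ₖ fromCols A B)`. -/
theorem fromCols_kronecker {ν ρ₂ ρ₁ : Type*} (c : Matrix l l ℝ) (A : Matrix ν ρ₂ ℝ) (B : Matrix ν ρ₁ ℝ) :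
    fromCols (c ⊗ₖ A) (c ⊗ₖ B) = reindex (Equiv.refl _) (e₂ l ρ₂ ρ₁) (c ⊗ₖ fromCols A B) := by
  ext a b
  rcases b with ⟨j, y⟩ | ⟨j, r⟩ <;> simp [Matrix.reindex_apply, Matrix.submatrix_apply, Matrix.kroneckerMap_apply, Matrix.fromCols]

omit [Fintype l] [Fintype ι] [DecidableEq l] [DecidableEq ι] in
/-- [folklore] the covariance-row shape `[D̄ ∣ 0]` lifts to `[c ⊗ D̄ ∣ 0]`: `reindex (refl) e₂ (c ⊗ₖ fromCols D̄ 0) = fromCols (c ⊗ₖ D̄) 0`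
(so a lifted `c1`-row `(c⊗Q₁₁)(1⊗W₀) + (1⊗Q₁₀)(c⊗W₁) = [c⊗D̄₁ ∣ 0]` is ONE `Matrix.mul_kronecker_mul` + the landed row + this lemma). -/
theorem kronecker_fromCols_zero {ν ρ₂ ρ₁ : Type*} (c : Matrix l l ℝ) (Dbar : Matrix ν ρ₂ ℝ) :
    reindex (Equiv.refl _) (e₂ l ρ₂ ρ₁) (c ⊗ₖ fromCols Dbar (0 : Matrix ν ρ₁ ℝ)) = fromCols (c ⊗ₖ Dbar) (0 : Matrix (l × ν) (l × ρ₁) ℝ) := by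
  rw [← Matrix.kronecker_zero c, fromCols_kronecker]

omit [Fintype l] [Fintype ι] [DecidableEq l] [DecidableEq ι] in
/-- [folklore] lifted generator jets act through the re-indexing: `(X) * reindex (refl) e₂ M = reindex (refl) e₂ (X * M)` — so letters stated
against `W := reindex (refl) e₂ (cⁿ ⊗ₖ fromCols W₂ W₁)` reduce to Kronecker algebra. -/
theorem mul_reindex_refl_e₂ {α ν ρ₂ ρ₁ : Type*} [Fintype l] [Fintype ν] (X : Matrix α (l × ν) ℝ) (M : Matrix (l × ν) (l × (ρ₂ ⊕ ρ₁)) ℝ) :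
    X * reindex (Equiv.refl _) (e₂ l ρ₂ ρ₁) M = reindex (Equiv.refl _) (e₂ l ρ₂ ρ₁) (X * M) := by
  ext a b; simp [Matrix.reindex_apply, Matrix.submatrix_apply, Matrix.mul_apply]

end Summit.QuantumFields.BalabanUV.Beta.FP.ColourDoubling

end
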